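import Summits.CriticalPhenomena.PercolationContinuityZ3.Theorems.PercNearOneGluingNoHeavyLowerTailTerminalTwoSum
import Summits.CriticalPhenomena.PercolationContinuityZ3.Theorems.PercNearOneGluingNoHeavyLowerTailThreeSumAtoms
import HarnessLib

/-!
# `NoHeavyLowerTail` (stmt-CriticalPhenomena-4575) — the `{b, v}`-cut for `q ≥ 1`: R1 on the far piece suffices

Support file (prover prim-gen-kcluster gen 72; `--supports stmt-CriticalPhenomena-4575`).  No definitions, no named facts, no sorries.
`TerminalTwoSum.r1_of_terminalTwoSum_of_r1`: for `q ≥ 1` the LG hypothesis of `TerminalTwoSum.r1_of_terminalTwoSum` follows from R1 on the far piece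
(`ThreeSum.lb_lg_of_r1`, gen 71), so R1 for `(v; b, c)` on the piece `Y` and `c ∈ cl DY b` give R1 for `(a; b, c)` on the glued graph.  Hence a minimal
counterexample to R1-RC(q ≥ 1) has no 2-cut `{b, v}` (or `{c, v}`) through a terminal with the other terminal's side joined in its support
(KCLUSTER-gen69 Cor. 4.3, now kernel modulo landing).
-/

noncomputable section

namespace Summit.CriticalPhenomena.PercolationContinuityZ3.Theorems

namespace TerminalTwoSum

open Finset SimpleGraph Literature.Probability.Percolation Literature.Probability.Percolation.Gladkov
open Literature.Probability.Percolation.BHK2006 (weight)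
open Literature.Probability.Percolation.DecisionTree (ind ind_of_mem ind_of_not_mem ind_nonneg)
open Literature.Probability.LatticeModels RefinedRowR3 ThreePointLB MeasureTheory
open scoped Classical

variable {V : Type*} [Fintype V]

section Corollary

variable {DX DY D : Finset (Sym2 V)} {a b c v : V} (hab : a ≠ b) (hav : a ≠ v) (hac : a ≠ c) (hbc : b ≠ c) (hvc : v ≠ c)
  (hvb : v ≠ b)
  (hsepD : ∀ x : V, (∃ e ∈ DX, x ∈ e) → (∃ e ∈ DY, x ∈ e) → (x = v ∨ x = b))
  (haY : ∀ e ∈ DY, a ∉ e) (hcX : ∀ e ∈ DX, c ∉ e) (hD : ∀ e, e ∈ D ↔ e ∈ DX ∨ e ∈ DY)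
  (w wX wY : Sym2 V → unitInterval) {q : ℝ} (hq : 1 ≤ q)
  (hw : ∀ e, e ∉ (↑DX ∪ ↑DY : Set (Sym2 V)) → (w e : ℝ) = 0)
  (hX : ∀ e ∈ (↑DX : Set (Sym2 V)), wX e = w e) (hX' : ∀ e ∉ (↑DX : Set (Sym2 V)), wX e = 0)
  (hY : ∀ e ∈ (↑DX : Set (Sym2 V)), wY e = 0) (hY' : ∀ e ∉ (↑DX : Set (Sym2 V)), wY e = w e)
include hab hav hac hbc hvc hvb hsepD haY hcX hD hq hw hX hX' hY hY'

/-- **The `{b, v}`-cut for `q ≥ 1`**: R1 for `(v; b, c)` on the far piece (and `c ∈ cl DY b`) implies R1 for `(a; b, c)` on the glued graph. [this work] -/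
theorem r1_of_terminalTwoSum_of_r1 (HY : c ∈ cl DY b)
    (hR1Y : (rcMeasureW wY q ∅).real {η : BondConfig V | b ∈ cl η.toFinset v ∧ c ∈ cl η.toFinset v} * (rcMeasureW wY q ∅).real {η : BondConfig V | b ∉ cl η.toFinset v ∧ c ∉ cl η.toFinset v ∧ Sep DY (cl η.toFinset v) b c} ≤ (rcMeasureW wY q ∅).real {η : BondConfig V | b ∈ cl η.toFinset v ∧ c ∉ cl η.toFinset v} * (rcMeasureW wY q ∅).real {η : BondConfig V | b ∉ cl η.toFinset v ∧ c ∈ cl η.toFinset v}) :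
    (rcMeasureW w q ∅).real {η : BondConfig V | b ∈ cl η.toFinset a ∧ c ∈ cl η.toFinset a} * (rcMeasureW w q ∅).real {η : BondConfig V | b ∉ cl η.toFinset a ∧ c ∉ cl η.toFinset a ∧ Sep D (cl η.toFinset a) b c} ≤ (rcMeasureW w q ∅).real {η : BondConfig V | b ∈ cl η.toFinset a ∧ c ∉ cl η.toFinset a} * (rcMeasureW w q ∅).real {η : BondConfig V | b ∉ cl η.toFinset a ∧ c ∈ cl η.toFinset a} := by
  have hq0 : 0 < q := one_pos.trans_le hq
  have hwY : ∀ e, e ∉ (↑DY : Set (Sym2 V)) → (wY e : ℝ) = 0 := by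
    intro e he
    by_cases heX : e ∈ (↑DX : Set (Sym2 V))
    · rw [hY e heX]; rfl
    · rw [hY' e heX]; exact hw e (fun h => h.elim heX he)
  obtain ⟨-, hLG⟩ := ThreeSum.lb_lg_of_r1 hvb hvc hbc wY hq hwY hR1Y
  exact r1_of_terminalTwoSum hab hav hac hbc hvc hvb hsepD haY hcX hD w wX wY hq0 hw hX hX' hY hY' HY hR1Y hLG

end Corollary

end TerminalTwoSum

end Summit.CriticalPhenomena.PercolationContinuityZ3.Theorems
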